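import Literature.AlgebraicGeometry.AbelianSchemes.PolarizedTupleGraphLetters
import Literature.AlgebraicGeometry.AbelianSchemes.PolarizedTupleIsomPiece
import Literature.AlgebraicGeometry.AbelianSchemes.PolarizedTupleIsoRebase
import HarnessLib

/-!
# The iso-locus of two PEL tuples is covered by FINITELY MANY FINITE-TYPE PIECES when the projective embeddings are given only on a finite family
# of CHARTS (head′ of the SP3-a2 line)

Topic `Literature/AlgebraicGeometry/AbelianSchemes`; namespace `Literature.AlgebraicGeometry.AbelianSchemes.AbelianSchemeOver`.  THEOREMS ONLY
(no definition, no named fact, no instance, no notation, no `sorry`).  Cell `hodgecm-mathlib` (D-0151), P6 «MOD programme» (crux hLiu418 =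
stmt-HodgeConjecture-24832), glue (G2) for the P-line socket `stub_INJ0` (LEAD F0P6-plan (g3) deal 2026-09-02 00:07:34Z (a)): the HEAD of the SP3-a2
line `Cruxes/HLiu418/Lines/F0_P6a_IsomSchemeFiniteType.isomPieces_finiteType_of_line` asks for closed `Y`-embeddings `jᵢ : 𝒜ᵢ ↪ 𝐏ⁿ_Y`; the
supplier REL-EMB-SPREAD (★ `ProjectiveGeometry/RelativeEmbeddingNearFibre`, ★ `AbelianSchemes/PolarizedAbelianSchemeLocalEmbedding`, B-p10 (g29))
delivers them ZARISKI-LOCALLY — on a finite family of charts of the (quasi-compact) stage.  This file re-assembles the head from the two ★ socket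
closers (★ `exists_finset_graphLetters_of_tupleIso`, ★ `exists_isomPiece_of_letters`) CHART BY CHART and pushes the pieces down to `Y`; the
conclusion is the head's output shape over `Y` VERBATIM (= the `hpieces` input of the cofinite passage ★
`Limits/CofinitePassageOfPieces.exists_finset_heightOneSpectrum_forall_not_of_pieces`, with `Φ t :=` the line's `TupleIsoAt₂ t …` UNFOLDED).
HC_CM is proved only modulo the 2 remaining named inputs (hLiu418, h413) until rung 0 closes; this file is generic and count-neutral.

## The mathematics ([MumfordFogartyKirwan1994] Ch. 7 §2, proof of Prop. 7.3 ∕ Thm. 7.9; [GortzWedhorn2020] (4.7))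

Let `(𝒜ᵢ, ιᵢ, (Âᵢ, 𝒫ᵢ), λᵢ, lvlᵢ)` (`i = 1, 2`) be PEL tuples over a scheme `Y` and `(c_α : Y_α → Y)_α` a FINITE family of quasi-compact, locally
finite-type charts with `Y_α` Noetherian through which every geometric point of `Y` lifts (e.g. a finite affine open cover of a Noetherian `Y`),
such that on each chart the pulled-back abelian schemes carry closed embeddings `jᵢα : c_α^*𝒜ᵢ ↪ 𝐏^{n_α}_{Y_α}` (`n_α ≥ 1`) whose `𝒪(1)` is
`L^Δ(λᵢ)^{⊗k_α}` (the binders of ★ `exists_finset_graphLetters_of_tupleIso`).  Then there are finitely many `Y`-schemes `I_ν → Y`, quasi-compact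
and locally of finite type, such that a geometric point `t` of `Y` lifts to some `I_ν` iff the tuples `𝒜₁, 𝒜₂` are isomorphic at `t` (the five
clauses of Mumford's moduli functor along `𝟙`).  Indeed over each chart the letters of tuple-isomorphisms lie in a finite set `F_α` and for each
`(Q, Q′) ∈ F_α` the `Isom`-piece `I_{α,(Q,Q′)} → Y_α` exists (★); compose with `c_α`; a point `t = t′ ≫ c_α` carries a tuple-isomorphism of
`𝒜₁, 𝒜₂` iff `t′` carries one of `c_α^*𝒜₁, c_α^*𝒜₂` (rebase ★ `exists_tupleIso₂_comp_iff`: base change is transitive).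

* **`exists_isomPieces_of_charts`** — the head′.

## References
* [MumfordFogartyKirwan1994] D. Mumford, J. Fogarty, F. Kirwan, *Geometric Invariant Theory*, 3rd ed. (1994), Ch. 7 §2 Proposition 7.3 (p. 132),
  Theorem 7.9 (p. 139); Ch. 0 §5 (c) (p. 23).
* [GortzWedhorn2020] U. Görtz, T. Wedhorn, *Algebraic Geometry I*, 2nd ed. (2020), Section (4.7) (pp. 107–108).
* [EGAIV3] A. Grothendieck, J. Dieudonné, *Éléments de géométrie algébrique IV₃*, Publ. Math. IHÉS 28 (1966), (8.9.1), (9.2.1)–(9.2.3)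
  (spreading embeddings to a neighbourhood; constructibility).
-/

set_option autoImplicit false

noncomputable section

-- Mathlib's `Over`/pull-back API is stated across semireducible wrappers (as in the ★ `AbelianSchemes/*` files).
set_option backward.isDefEq.respectTransparency false

open CategoryTheory CategoryTheory.Limits CategoryTheory.Abelian AlgebraicGeometry Polynomial MonoidalCategory

namespace Literature.AlgebraicGeometry.AbelianSchemes

namespace AbelianSchemeOver

open Literature.AlgebraicGeometry Literature.AlgebraicGeometry.Morphisms
open Literature.AlgebraicGeometry.Modules Literature.AlgebraicGeometry.Modules.SerreTwist
open Literature.Algebra.Homology Literature.Algebra.Homology.LaurentCech Literature.Algebra.Homology.OrderedCech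
open Literature.AlgebraicGeometry.AbelianVarieties Literature.AlgebraicGeometry.Motives

/-- **HEAD′ — THE ISO-LOCUS OF TWO PEL TUPLES IS THE IMAGE OF FINITELY MANY QUASI-COMPACT FINITE-TYPE `Y`-SCHEMES, the embeddings being given
on a finite family of charts.**  Data: two tuples over `Y`; charts `c α : Yc α → Y` (`α : ι`, `ι` finite), each quasi-compact and locally of finite
type with `Yc α` Noetherian, every geometric point of `Y` lifting to some chart (`hcov`); on each chart the ★ `exists_finset_graphLetters_of_tupleIso`
binders for the pulled-back tuples `c_α^*𝒜ᵢ` (graphs `Grᵢ α` of `λᵢ`, closed embeddings `jᵢ α` into ONE `𝐏(Fin (n α))` over `Yc α` with `1 ≤ n α`,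
`𝒪(1) ≅ L^Δ(λᵢ)^{⊗(k α)}` as `eᵢ α`).  Conclusion (the SP3-a2 head's output over `Y`, `TupleIsoAt₂` UNFOLDED): finitely many `f ν : I ν → Y`,
quasi-compact and locally of finite type, with «the tuples are isomorphic at `t`» ⟺ «`t` lifts to some `I ν`» for every geometric point `t`.
PROOF: chart by chart ★ `exists_finset_graphLetters_of_tupleIso` (finite letter set) and ★ `exists_isomPiece_of_letters` (one piece per letter
pair), pieces composed with `c α`, points rebased along `c α` by ★ `exists_tupleIso₂_comp_iff`, the finite index set `Σ α, F α` enumerated by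
`Fintype.equivFin`. [cite: MumfordFogartyKirwan1994, Ch. 7 §2 Proposition 7.3 (p. 132) and Theorem 7.9 (p. 139)]
[cite: GortzWedhorn2020, Section (4.7) (pp. 107–108)] -/
theorem exists_isomPieces_of_charts {O : Type} [CommRing O] {Y : Scheme.{0}}
    (𝒜₁ : AbelianSchemeOver Y) (ρ₁ : 𝒜₁.RingAction O) (D₁ : 𝒜₁.DualPair) (pol₁ : 𝒜₁.Polarization D₁)
    {g N : ℕ} (lvl₁ : 𝒜₁.LevelStructure g N)
    (𝒜₂ : AbelianSchemeOver Y) (ρ₂ : 𝒜₂.RingAction O) (D₂ : 𝒜₂.DualPair) (pol₂ : 𝒜₂.Polarization D₂)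
    (lvl₂ : 𝒜₂.LevelStructure g N)
    -- the charts
    {ι : Type} [Fintype ι] (Yc : ι → Scheme.{0}) [∀ α, IsNoetherian (Yc α)] (c : ∀ α, Yc α ⟶ Y)
    [∀ α, QuasiCompact (c α)] [∀ α, LocallyOfFiniteType (c α)]
    (hcov : ∀ ⦃Ω : Type⦄ [Field Ω] [IsAlgClosed Ω] (t : Spec (CommRingCat.of Ω) ⟶ Y),
      ∃ (α : ι) (t' : Spec (CommRingCat.of Ω) ⟶ Yc α), t' ≫ c α = t)
    -- the embeddings, chart by chart (binders of ★ `exists_finset_graphLetters_of_tupleIso` for `c_α^*𝒜₁`, `c_α^*𝒜₂`)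
    (n k : ι → ℕ) (hn : ∀ α, 1 ≤ n α)
    (Gr₁ : ∀ α, (𝒜₁.baseChange (c α)).X.left ⟶ (𝒜₁.baseChange (c α)).prodLeft (D₁.baseChange (c α)).hat)
    (Gr₂ : ∀ α, (𝒜₂.baseChange (c α)).X.left ⟶ (𝒜₂.baseChange (c α)).prodLeft (D₂.baseChange (c α)).hat)
    (hGr₁₁ : ∀ α, Gr₁ α ≫ pullback.fst (𝒜₁.baseChange (c α)).X.hom (D₁.baseChange (c α)).hat.X.hom = 𝟙 _)
    (hGr₁₂ : ∀ α, Gr₁ α ≫ pullback.snd (𝒜₁.baseChange (c α)).X.hom (D₁.baseChange (c α)).hat.X.hom = (pol₁.baseChange (c α)).lam.left)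
    (hGr₂₁ : ∀ α, Gr₂ α ≫ pullback.fst (𝒜₂.baseChange (c α)).X.hom (D₂.baseChange (c α)).hat.X.hom = 𝟙 _)
    (hGr₂₂ : ∀ α, Gr₂ α ≫ pullback.snd (𝒜₂.baseChange (c α)).X.hom (D₂.baseChange (c α)).hat.X.hom = (pol₂.baseChange (c α)).lam.left)
    (j₁ : ∀ α, (𝒜₁.baseChange (c α)).X.left ⟶ Morphisms.projectiveSpace (Fin (n α)) (Yc α))
    (hj₁ : ∀ α, j₁ α ≫ Morphisms.projectiveSpaceFst (Fin (n α)) (Yc α) = (𝒜₁.baseChange (c α)).X.hom)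
    (j₂ : ∀ α, (𝒜₂.baseChange (c α)).X.left ⟶ Morphisms.projectiveSpace (Fin (n α)) (Yc α))
    (hj₂ : ∀ α, j₂ α ≫ Morphisms.projectiveSpaceFst (Fin (n α)) (Yc α) = (𝒜₂.baseChange (c α)).X.hom)
    (hj₁c : ∀ α, IsClosedImmersion (j₁ α)) (hj₂c : ∀ α, IsClosedImmersion (j₂ α))
    (e₁ : ∀ α, twistMod (j₁ α ≫ pullback.snd (terminal.from (Yc α)) (terminal.from (Morphisms.projectiveSpaceInt (Fin (n α)))))
      (unitModule _) 1 ≅ tensorPow ((Scheme.Modules.pullback (Gr₁ α)).obj (D₁.baseChange (c α)).P) (k α))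
    (e₂ : ∀ α, twistMod (j₂ α ≫ pullback.snd (terminal.from (Yc α)) (terminal.from (Morphisms.projectiveSpaceInt (Fin (n α)))))
      (unitModule _) 1 ≅ tensorPow ((Scheme.Modules.pullback (Gr₂ α)).obj (D₂.baseChange (c α)).P) (k α)) :
    ∃ (r : ℕ) (I : Fin r → Scheme.{0}) (f : ∀ i, I i ⟶ Y) (_ : ∀ i, QuasiCompact (f i))
      (_ : ∀ i, LocallyOfFiniteType (f i)),
      ∀ ⦃Ω : Type⦄ [Field Ω] [IsAlgClosed Ω] (t : Spec (CommRingCat.of Ω) ⟶ Y),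
        (∃ (G : (𝒜₁.baseChange t).X.left ⟶ (𝒜₂.baseChange t).X.left) (Ĝ : (D₁.baseChange t).hat.X.left ⟶ (D₂.baseChange t).hat.X.left),
          (lvl₁.baseChange t).IsBaseChangeVia (lvl₂.baseChange t) (𝟙 (Spec (CommRingCat.of Ω))) G ∧
          (D₁.baseChange t).hat.IsBaseChangeVia (D₂.baseChange t).hat (𝟙 (Spec (CommRingCat.of Ω))) Ĝ ∧
          (∃ (wG : (𝒜₁.baseChange t).X.hom ≫ 𝟙 (Spec (CommRingCat.of Ω)) = G ≫ (𝒜₂.baseChange t).X.hom)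
              (wĜ : (D₁.baseChange t).hat.X.hom ≫ 𝟙 (Spec (CommRingCat.of Ω)) = Ĝ ≫ (D₂.baseChange t).hat.X.hom),
            Nonempty ((Scheme.Modules.pullback
              (pullback.map (𝒜₁.baseChange t).X.hom (D₁.baseChange t).hat.X.hom (𝒜₂.baseChange t).X.hom (D₂.baseChange t).hat.X.hom G Ĝ (𝟙 (Spec (CommRingCat.of Ω))) wG wĜ)).obj
                (D₂.baseChange t).P ≅ (D₁.baseChange t).P)) ∧
          (pol₁.baseChange t).lam.left ≫ Ĝ = G ≫ (pol₂.baseChange t).lam.left ∧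
          ∀ a : O, (baseChangeHom (ρ₁.i a) t).left ≫ G = G ≫ (baseChangeHom (ρ₂.i a) t).left) ↔
          ∃ (i : Fin r) (s : Spec (CommRingCat.of Ω) ⟶ I i), s ≫ f i = t := by
  classical
  -- chart by chart: the finite letter set (★ ILET closer) and one piece per letter pair (★ ICON closer)
  choose F hF using fun α => exists_finset_graphLetters_of_tupleIso (𝒜₁.baseChange (c α)) (ρ₁.baseChange (c α)) (D₁.baseChange (c α))
    (pol₁.baseChange (c α)) (lvl₁.baseChange (c α)) (𝒜₂.baseChange (c α)) (ρ₂.baseChange (c α)) (D₂.baseChange (c α)) (pol₂.baseChange (c α))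
    (lvl₂.baseChange (c α)) (Gr₁ α) (Gr₂ α) (j₁ α) (hj₁ α) (j₂ α) (hj₂ α) (hn α) (hGr₁₁ α) (hGr₁₂ α) (hGr₂₁ α) (hGr₂₂ α) (hj₁c α) (hj₂c α)
    (e₁ α) (e₂ α)
  choose I m hqc hlft hI using fun (α : ι) (QQ' : ℚ[X] × ℚ[X]) => exists_isomPiece_of_letters (𝒜₁.baseChange (c α)) (ρ₁.baseChange (c α))
    (D₁.baseChange (c α)) (pol₁.baseChange (c α)) (lvl₁.baseChange (c α)) (𝒜₂.baseChange (c α)) (ρ₂.baseChange (c α)) (D₂.baseChange (c α))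
    (pol₂.baseChange (c α)) (lvl₂.baseChange (c α)) (j₁ α) (hj₁ α) (j₂ α) (hj₂ α) (hn α) (hj₁c α) (hj₂c α) QQ'.1 QQ'.2
  -- the pieces over `Y`, indexed by `J := Σ α, F α`
  have key : ∀ ⦃Ω : Type⦄ [Field Ω] [IsAlgClosed Ω] (t : Spec (CommRingCat.of Ω) ⟶ Y),
        (∃ (G : (𝒜₁.baseChange t).X.left ⟶ (𝒜₂.baseChange t).X.left) (Ĝ : (D₁.baseChange t).hat.X.left ⟶ (D₂.baseChange t).hat.X.left),
          (lvl₁.baseChange t).IsBaseChangeVia (lvl₂.baseChange t) (𝟙 (Spec (CommRingCat.of Ω))) G ∧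
          (D₁.baseChange t).hat.IsBaseChangeVia (D₂.baseChange t).hat (𝟙 (Spec (CommRingCat.of Ω))) Ĝ ∧
          (∃ (wG : (𝒜₁.baseChange t).X.hom ≫ 𝟙 (Spec (CommRingCat.of Ω)) = G ≫ (𝒜₂.baseChange t).X.hom)
              (wĜ : (D₁.baseChange t).hat.X.hom ≫ 𝟙 (Spec (CommRingCat.of Ω)) = Ĝ ≫ (D₂.baseChange t).hat.X.hom),
            Nonempty ((Scheme.Modules.pullback
              (pullback.map (𝒜₁.baseChange t).X.hom (D₁.baseChange t).hat.X.hom (𝒜₂.baseChange t).X.hom (D₂.baseChange t).hat.X.hom G Ĝ (𝟙 (Spec (CommRingCat.of Ω))) wG wĜ)).obj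
                (D₂.baseChange t).P ≅ (D₁.baseChange t).P)) ∧
          (pol₁.baseChange t).lam.left ≫ Ĝ = G ≫ (pol₂.baseChange t).lam.left ∧
          ∀ a : O, (baseChangeHom (ρ₁.i a) t).left ≫ G = G ≫ (baseChangeHom (ρ₂.i a) t).left) ↔
        ∃ (p : Σ α, (F α : Set (ℚ[X] × ℚ[X]))) (s : Spec (CommRingCat.of Ω) ⟶ I p.1 p.2.1), s ≫ m p.1 p.2.1 ≫ c p.1 = t := by
    intro Ω _ _ t
    constructor
    · intro h
      obtain ⟨α, t', rfl⟩ := hcov t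
      obtain ⟨G, Ĝ, h5⟩ := (exists_tupleIso₂_comp_iff 𝒜₁ ρ₁ D₁ pol₁ lvl₁ 𝒜₂ ρ₂ D₂ pol₂ lvl₂ (c α) t').mp h
      obtain ⟨QQ', hmem, hQ, hQ'⟩ := hF α t' G Ĝ h5
      obtain ⟨s, hs⟩ := (hI α QQ' t').mp ⟨G, Ĝ, h5, hQ, hQ'⟩
      exact ⟨⟨α, QQ', hmem⟩, s, by rw [← Category.assoc, hs]⟩
    · rintro ⟨⟨α, QQ', hmem⟩, s, hs⟩
      obtain ⟨G, Ĝ, h5, -, -⟩ := (hI α QQ' (s ≫ m α QQ')).mpr ⟨s, rfl⟩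
      have hst : (s ≫ m α QQ') ≫ c α = t := by rw [Category.assoc]; exact hs
      subst hst
      exact (exists_tupleIso₂_comp_iff 𝒜₁ ρ₁ D₁ pol₁ lvl₁ 𝒜₂ ρ₂ D₂ pol₂ lvl₂ (c α) (s ≫ m α QQ')).mpr ⟨G, Ĝ, h5⟩
  -- enumerate `J` by `Fin r`
  let ε := Fintype.equivFin (Σ α, (F α : Set (ℚ[X] × ℚ[X])))
  refine ⟨Fintype.card (Σ α, (F α : Set (ℚ[X] × ℚ[X]))), fun i => I (ε.symm i).1 (ε.symm i).2.1,
    fun i => m (ε.symm i).1 (ε.symm i).2.1 ≫ c (ε.symm i).1, fun i => ?_, fun i => ?_, fun Ω _ _ t => ?_⟩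
  · haveI := hqc (ε.symm i).1 (ε.symm i).2.1
    infer_instance
  · haveI := hlft (ε.symm i).1 (ε.symm i).2.1
    infer_instance
  rw [key t]
  constructor
  · rintro ⟨p, s, hs⟩
    refine ⟨ε p, ?_⟩
    dsimp only
    rw [Equiv.symm_apply_apply]
    exact ⟨s, hs⟩
  · rintro ⟨i, s, hs⟩
    exact ⟨ε.symm i, s, hs⟩

end AbelianSchemeOver

end Literature.AlgebraicGeometry.AbelianSchemes

end
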